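import Summits.Parity.GeneralizedHardyLittlewood.Theorems.FordMaynardSieveConst01651SieveConst01651PiecesTab
import HarnessLib

/-!
# Route `FordMaynardSieveConst01651`, target `SieveConst01651` (stmt-Parity-19185), stub `stub_coneCertClosed`:
# the stub REDUCED to its two computational residues, and the evaluation API of the witness

Def-free helper file.  `stub_coneCertClosed_of_residues` proves the registered stub signature VERBATIM from exactly
three hypotheses about the explicit witness `coneCert` (`…Witness`):

* `h4`, `h5` — the sign clause in dimensions `4` and `5` (the certifier's (H1) on `55 225 + 86 966` open types; a
  finite rational check once `coneCert` is evaluated through the API below), and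
* `hV : 0 < sieveBoundG1 (1651/10000) coneCert` — the certificate value (certified OUTSIDE Lean by Arb ball arithmetic
  as `0.002706498 ± 3.7·10⁻¹⁰`; kit job j242906 of parity-ideate-p3).

Everything else — conjunct (i) (`isPiecewiseConstOnCone_coneCert`), (ii), (iii), and dimensions `2, 3, 6` of (iv) — is
PROVED in the tree.  The evaluation API (`coneCert_one_eq`, `coneCert_two_eq_lookup`, `coneCert_two_eq_zero_of_half_lt`,
`coneCert_three_eq_lookup`, `coneCert_three_eq_zero_of_half_lt`, `gFace_eq_zero_of_generic…`) is what a soundness proof of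
a type checker for `h4`, `h5` consumes: at GENERIC points the witness is a table lookup.

References: [FordMaynard2024PrimeSieves] arXiv:2407.14368, Theorem 7.3 (a), §8.2.
-/

noncomputable section

open Finset
open scoped Classical
open Literature.NumberTheory.Sieve Literature.NumberTheory.Sieve.FordMaynard

namespace Summit.Parity.GeneralizedHardyLittlewood.FordMaynardSieveConst01651SieveConst01651

/-! ### The stub modulo its residues -/

/-- **`stub_coneCertClosed` from its two computational residues.** The registered signature of `stub_coneCertClosed`
(line `sieve_decomposition`, crux `SieveConst01651`), verbatim, follows from the dimension-`4` and dimension-`5` sign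
checks for `coneCert` and the positivity of its certificate value; the witness is `coneCert`.
[cite: FordMaynard2024PrimeSieves, Theorem 7.3 (a), §8.2] -/
theorem stub_coneCertClosed_of_residues
    (h4 : ∀ x : Fin 4 → ℝ, Monotone x → (∀ i, (1651 / 10000 : ℝ) < x i ∧ x i < 1 - 1651 / 10000) →
      ∑ i, x i = 1 → starSum coneCert 4 x ≤ 0)
    (h5 : ∀ x : Fin 5 → ℝ, Monotone x → (∀ i, (1651 / 10000 : ℝ) < x i ∧ x i < 1 - 1651 / 10000) →
      ∑ i, x i = 1 → starSum coneCert 5 x ≤ 0)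
    (hV : 0 < sieveBoundG1 (1651 / 10000) coneCert) :
    ∃ g₀ : VecFn, IsPiecewiseConstOnCone g₀ ∧ (∀ e : Fin 0 → ℝ, g₀ 0 e = 1) ∧
      (∀ (k : ℕ) (x : Fin k → ℝ), Monotone x → g₀ k x ≠ 0 →
        k = 0 ∨ ((∀ i, (1651 / 10000 : ℝ) < x i) ∧ ∑ i, x i ≤ 1 / 2)) ∧
      (∀ k : ℕ, 2 ≤ k → k ≤ 6 → ∀ x : Fin k → ℝ, Monotone x →
        (∀ i, (1651 / 10000 : ℝ) < x i ∧ x i < 1 - 1651 / 10000) → ∑ i, x i = 1 → starSum g₀ k x ≤ 0) ∧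
      0 < sieveBoundG1 (1651 / 10000) g₀ :=
  ⟨coneCert, isPiecewiseConstOnCone_coneCert, coneCert_empty, coneCert_support,
    coneCert_signClause_of_four_five h4 h5, hV⟩

/-! ### Evaluation API of the witness at generic points -/

/-- Off the faces the face part vanishes: no coordinate on an edge, no pair sum on a band line, total `≠ 1/2`.
[folklore] -/
theorem gFace_eq_zero_of_generic {r : ℕ} {y : Fin r → ℝ} (he : ∀ i, y i ∉ edgeSet)
    (hp : ∀ i j, i < j → y i + y j ≠ 8349 / 20000 ∧ y i + y j ≠ 1 / 2) (ht : r = 3 → ∑ i, y i ≠ 1 / 2) :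
    gFace r y = 0 := by
  unfold gFace
  split_ifs with h
  · have hc : faceCount r y = 0 := by
      unfold faceCount
      have h1 : (Finset.univ.filter (fun i : Fin r => y i ∈ edgeSet)).card = 0 := by
        rw [Finset.card_eq_zero, Finset.filter_eq_empty_iff]; exact fun i _ => he i
      have h2 : (Finset.univ.filter (fun q : Fin r × Fin r => q.1 < q.2 ∧ y q.1 + y q.2 = 8349 / 20000)).card = 0 := by
        rw [Finset.card_eq_zero, Finset.filter_eq_empty_iff]
        exact fun q _ hq => (hp q.1 q.2 hq.1).1 hq.2
      have h3 : (Finset.univ.filter (fun q : Fin r × Fin r => q.1 < q.2 ∧ y q.1 + y q.2 = 1 / 2)).card = 0 := by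
        rw [Finset.card_eq_zero, Finset.filter_eq_empty_iff]
        exact fun q _ hq => (hp q.1 q.2 hq.1).2 hq.2
      have h4 : (if r = 3 ∧ ∑ i, y i = 1 / 2 then 1 else 0) = 0 := by
        rw [if_neg]; rintro ⟨h3, hs⟩; exact ht h3 hs
      rw [h1, h2, h3, h4]
    rw [hc]; simp
  · rfl

/-- `coneCert₁(t) = −1` for `ν₀ < t ≤ 1/2` off the edges. [folklore] -/
theorem coneCert_one_eq (y : Fin 1 → ℝ) (h1 : (1651 / 10000 : ℝ) < y 0) (h2 : y 0 ≤ 1 / 2) (he : y 0 ∉ edgeSet) :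
    coneCert 1 y = -1 := by
  show gTab 1 y + gFace 1 y = -1
  have hT : gTab 1 y = -1 := by show (if _ then _ else _ : ℝ) = -1; rw [if_pos ⟨h1, h2⟩]
  have hF : gFace 1 y = 0 :=
    gFace_eq_zero_of_generic (fun i => by have : i = 0 := Subsingleton.elim _ _; subst this; exact he)
      (fun i j hij => absurd hij (by have := Subsingleton.elim i j; subst this; exact lt_irrefl _)) (by omega)
  rw [hT, hF, add_zero]

/-- `coneCert₁(t) = 0` for `t > 1/2`. [folklore] -/
theorem coneCert_one_eq_zero_of_half_lt (y : Fin 1 → ℝ) (h : 1 / 2 < y 0) : coneCert 1 y = 0 := by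
  show gTab 1 y + gFace 1 y = 0
  have hT : gTab 1 y = 0 := by
    show (if _ then _ else _ : ℝ) = 0; rw [if_neg (by rintro ⟨-, h2⟩; linarith)]
  have hF : gFace 1 y = 0 := by
    unfold gFace; rw [if_neg]; rintro ⟨-, -, -, -, hs⟩; rw [Fin.sum_univ_one] at hs; linarith
  rw [hT, hF, add_zero]

/-- **Generic pairs read the table**: for `y₀ ≤ y₁` in open small cells with `y₀ + y₁ < 1/2` off the band line,
`coneCert₂(y) = g2Lookup (cellIdx y₀) (cellIdx y₁) (bandIdx (y₀+y₁)) / 10⁶`. [folklore] -/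
theorem coneCert_two_eq_lookup (y : Fin 2 → ℝ) (hy : y 0 ≤ y 1) (h0 : y 0 ∈ openSmall) (h1 : y 1 ∈ openSmall)
    (hne : y 0 + y 1 ≠ 8349 / 20000) (hlt : y 0 + y 1 < 1 / 2) :
    coneCert 2 y = ((g2Lookup (cellIdx (y 0)) (cellIdx (y 1)) (bandIdx (y 0 + y 1)) : ℤ) : ℝ) / 1000000 := by
  show gTab 2 y + gFace 2 y = _
  have hT : gTab 2 y = ((g2Lookup (cellIdx (y 0)) (cellIdx (y 1)) (bandIdx (y 0 + y 1)) : ℤ) : ℝ) / 1000000 := by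
    show (if _ then _ else _ : ℝ) = _; rw [if_pos ⟨hy, h0, h1, hne, hlt⟩]
  have hF : gFace 2 y = 0 := by
    refine gFace_eq_zero_of_generic ?_ ?_ (by omega)
    · intro i; fin_cases i
      · exact h0.2.2
      · exact h1.2.2
    · intro i j hij
      fin_cases i <;> fin_cases j
      · exact absurd hij (lt_irrefl _)
      · exact ⟨hne, hlt.ne⟩
      · exact absurd hij (by decide)
      · exact absurd hij (lt_irrefl _)
  rw [hT, hF, add_zero]

/-- A pair with `y₀ + y₁ > 1/2` carries nothing (support). [folklore] -/
theorem coneCert_two_eq_zero_of_half_lt (y : Fin 2 → ℝ) (hy : Monotone y) (h : 1 / 2 < y 0 + y 1) :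
    coneCert 2 y = 0 := by
  by_contra hne
  rcases coneCert_support 2 y hy hne with h0 | ⟨-, hs⟩
  · exact absurd h0 (by norm_num)
  · rw [Fin.sum_univ_two] at hs; linarith

/-- **Generic triples read the table**: monotone, all coordinates in open small cells, `|y| < 1/2`, no pair sum on a
band line: `coneCert₃(y) = g3Lookup (cellIdx y₀) (cellIdx y₁) (cellIdx y₂) / 10⁶`. [folklore] -/
theorem coneCert_three_eq_lookup (y : Fin 3 → ℝ) (hy : Monotone y) (ho : ∀ i, y i ∈ openSmall)
    (hp : ∀ i j, i < j → y i + y j ≠ 8349 / 20000 ∧ y i + y j ≠ 1 / 2) (hlt : ∑ i, y i < 1 / 2) :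
    coneCert 3 y = ((g3Lookup (cellIdx (y 0)) (cellIdx (y 1)) (cellIdx (y 2)) : ℤ) : ℝ) / 1000000 := by
  show gTab 3 y + gFace 3 y = _
  have hT : gTab 3 y = ((g3Lookup (cellIdx (y 0)) (cellIdx (y 1)) (cellIdx (y 2)) : ℤ) : ℝ) / 1000000 := by
    show (if _ then _ else _ : ℝ) = _; rw [if_pos ⟨hy, ho, hlt⟩]
  have hF : gFace 3 y = 0 := gFace_eq_zero_of_generic (fun i => (ho i).2.2) hp (fun _ => hlt.ne)
  rw [hT, hF, add_zero]

/-- A triple with `|y| > 1/2` carries nothing (support). [folklore] -/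
theorem coneCert_three_eq_zero_of_half_lt (y : Fin 3 → ℝ) (hy : Monotone y) (h : 1 / 2 < ∑ i, y i) :
    coneCert 3 y = 0 := by
  by_contra hne
  rcases coneCert_support 3 y hy hne with h0 | ⟨-, hs⟩
  · exact absurd h0 (by norm_num)
  · linarith

/-- Subvectors of dimension `≥ 4` carry nothing. [folklore] -/
theorem coneCert_eq_zero_of_four_le (n : ℕ) (y : Fin (n + 4) → ℝ) (hy : Monotone y)
    (hbox : ∀ i, (1651 / 10000 : ℝ) < y i) : coneCert (n + 4) y = 0 := by
  by_contra hne
  rcases coneCert_support (n + 4) y hy hne with h0 | ⟨-, hs⟩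
  · omega
  · have : ∑ _i : Fin (n + 4), (1651 / 10000 : ℝ) < ∑ i, y i :=
      Finset.sum_lt_sum_of_nonempty Finset.univ_nonempty (fun i _ => hbox i)
    rw [Finset.sum_const, Finset.card_univ, Fintype.card_fin, nsmul_eq_mul] at this
    push_cast at this
    nlinarith

end Summit.Parity.GeneralizedHardyLittlewood.FordMaynardSieveConst01651SieveConst01651

end
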